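import Mathlib
import HarnessLib
import Summits.Langlands.Langlands.Statement
import Literature.NumberTheory.GaloisRepresentations.FramedRepTwist
import Literature.NumberTheory.GaloisRepresentations.LAdicRepFrobenius
import Literature.NumberTheory.GaloisRepresentations.GlobalArtinMapOfCharactersProofs
import Literature.NumberTheory.GaloisRepresentations.ArtinReciprocityCharacterFiniteProofs
import Literature.NumberTheory.Automorphic.ClassFieldCharacterFrobenius
import Literature.NumberTheory.Automorphic.ChebotarevArtinRepHolds
import Literature.NumberTheory.Automorphic.TunnellOctahedralGlobal

/-!
# Stub `stub_quadraticBaseChangeTwist` (line `descend-raise-basechange`), auxiliary file 1: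
# a `π` whose Galois representation stays irreducible on `Γ_F` is not dihedral by `F`

Support file for the crux `EisensteinProModularSeed` (stmt-Langlands-12920), stub S4; everything is
**proved**, no named fact.  The named fact `baseChange_cyclic_cuspidal` (Arthur–Clozel, Ch. 3,
Thm. 4.2 (a), datum model) needs `π ≇ π ⊗ η_{F/K}` rendered on local data: at some place `v` of `K`
inert in `F`, `π` has a Satake parameter `α` with `-α ≠ α`.  We derive it from the Galois side
(`exists_inert_hasSatakeParamAt_map_ne`): if `ρ : Γ_K → GL₂(ℚ̄_p)` is Satake–Frobenius compatible
with `π` almost everywhere and `ρ|_{Γ_F}` is irreducible, such a place exists.  Otherwise the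
Frobenii of `ρ` at almost all inert primes have trace zero, so `ρ` and its twist `ρ ⊗ ε_F` by the
quadratic character of `F/K` have the same Frobenius characteristic polynomials almost everywhere;
both are irreducible, hence `ρ ≅ ρ ⊗ ε_F` (Chebotarev + Brauer–Nesbitt,
`FramedGaloisRep.nonempty_equiv_of_hasFrobCharpolyAt_eventually`); the intertwiner commutes with
`ρ(Γ_F)`, so is a scalar by Schur's lemma (Mathlib
`Representation.IsIrreducible.algebraMap_intertwiningMap_bijective_of_isAlgClosed`), forcing
`ε_F = 1` — absurd.  (Ribet 1977, §4: CM by `F` iff `a_ℓ = 0` at the inert `ℓ`.)  Contents: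
`isIrreducible_of_coe_eq_smul`, the sign character of a group of order `2` (`exists_signChar`), the
quadratic character of `Γ_K` cut out by a quadratic `L ⊆ K̄` (`exists_quadraticGaloisChar`) and its
behaviour at inertia and split Frobenii, and the main lemma.
-/

set_option linter.dupNamespace false -- project-wide option (lakefile weak.linter.dupNamespace); `Summit.Langlands.Langlands` is the mandated namespace

noncomputable section

open scoped MatrixGroups Matrix NumberField Polynomial Classical
open NumberField IsDedekindDomain Field Polynomial Filter
open Literature.NumberTheory.Automorphic Literature.NumberTheory.GaloisRepresentations

namespace Summit.Langlands.Langlands.Theorems.SkinnerWilesDefectOne.EisensteinProModularSeed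

/-! ## 1. Irreducibility descends along scalar renormalisations -/

section Descend

variable {K L : Type*} [Field K] [Field L] {A : Type*} [Field A] [TopologicalSpace A]
  [IsTopologicalRing A] {n : ℕ}

/-- **Irreducibility descends.**  If `r : Γ_L → GL_n(A)` and `ρ : Γ_K → GL_n(A)` satisfy
`r(σ) = c(σ) · ρ(φ σ)` for some map `φ : Γ_L → Γ_K` and scalars `c(σ)`, then every
`ρ`-stable subspace is `r`-stable; so if `r` is irreducible, `ρ` is irreducible.  (Used with
`φ` the restriction `Γ_F → Γ_ℚ` and `c = ν`, and with `φ = id`.) [folklore] -/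
theorem isIrreducible_of_coe_eq_smul (r : FramedGaloisRep L A n) (ρ : FramedGaloisRep K A n)
    (φ : absoluteGaloisGroup L → absoluteGaloisGroup K) (c : absoluteGaloisGroup L → A)
    (h : ∀ σ, ((r σ : GL (Fin n) A) : Matrix (Fin n) (Fin n) A) =
      c σ • ((ρ (φ σ) : GL (Fin n) A) : Matrix (Fin n) (Fin n) A))
    (hr : r.toGaloisRep.IsIrreducible) : ρ.toGaloisRep.IsIrreducible := by
  let T : Subrepresentation ρ.toGaloisRep.toRepresentation →
      Subrepresentation r.toGaloisRep.toRepresentation := fun W =>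
    ⟨W.toSubmodule, fun σ v hv => by
      have e : r.toGaloisRep.toRepresentation σ v = c σ • ρ.toGaloisRep.toRepresentation (φ σ) v := by
        change ((r σ : GL (Fin n) A) : Matrix (Fin n) (Fin n) A) *ᵥ v =
          c σ • (((ρ (φ σ) : GL (Fin n) A) : Matrix (Fin n) (Fin n) A) *ᵥ v)
        rw [h σ, Matrix.smul_mulVec]
      rw [e]
      exact W.toSubmodule.smul_mem _ (W.apply_mem_toSubmodule (φ σ) hv)⟩
  have hT : ∀ W, (T W).toSubmodule = W.toSubmodule := fun W => rfl
  haveI := hr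
  have hbt : (⊥ : Subrepresentation r.toGaloisRep.toRepresentation) ≠ ⊤ := bot_ne_top
  refine { exists_pair_ne := ⟨⊥, ⊤, fun hbt' => hbt ?_⟩, eq_bot_or_eq_top := fun W => ?_ }
  · exact Subrepresentation.toSubmodule_injective
      (congrArg Subrepresentation.toSubmodule hbt' :)
  · refine (IsSimpleOrder.eq_bot_or_eq_top (T W)).imp (fun h0 => ?_) (fun h1 => ?_) <;>
      apply Subrepresentation.toSubmodule_injective
    · rw [← hT W, h0]; rfl
    · rw [← hT W, h1]; rfl

end Descend

/-! ## 2. The sign character of a group of order two -/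

section Sign

variable {G : Type*} [Group G]

/-- A group of order `2` is `{1, g₀}`. [folklore] -/
theorem exists_ne_one_forall_eq_of_card_eq_two (hG : Nat.card G = 2) :
    ∃ g₀ : G, g₀ ≠ 1 ∧ ∀ g : G, g = 1 ∨ g = g₀ := by
  obtain ⟨g₀, hg₀, huniq⟩ := (Nat.card_eq_two_iff' (1 : G)).mp hG
  exact ⟨g₀, hg₀, fun g => (eq_or_ne g 1).imp id (huniq g)⟩

/-- In a group of order `2` every element squares to `1`. [folklore] -/
theorem mul_self_eq_one_of_card_eq_two (hG : Nat.card G = 2) (g : G) : g * g = 1 := by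
  rw [← pow_two, ← hG]; exact pow_card_eq_one'

variable (A : Type*) [CommRing A]

open scoped Classical in
/-- **The sign character** of a group of order `2` with values in `Aˣ` (`1 ↦ 1`, `g₀ ↦ -1`):
a homomorphism `s : G → Aˣ` with values `±1` and `s(g) = -1` for `g ≠ 1`. [folklore] -/
theorem exists_signChar (hG : Nat.card G = 2) :
    ∃ s : G →* Aˣ, (∀ g, s g = 1 ∨ s g = -1) ∧ ∀ g, g ≠ 1 → s g = -1 := by
  obtain ⟨g₀, hg₀, hall⟩ := exists_ne_one_forall_eq_of_card_eq_two hG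
  refine ⟨⟨⟨fun g => if g = 1 then 1 else -1, if_pos rfl⟩, fun g h => ?_⟩,
    fun g => ?_, fun g hg => if_neg hg⟩
  · change (if g * h = 1 then (1 : Aˣ) else -1) = (if g = 1 then 1 else -1) * (if h = 1 then 1 else -1)
    rcases hall g with rfl | rfl <;> rcases hall h with rfl | rfl
    · simp
    · simp [hg₀]
    · simp [hg₀]
    · rw [mul_self_eq_one_of_card_eq_two hG, if_pos rfl, if_neg hg₀]
      simp
  · change (if g = 1 then (1 : Aˣ) else -1) = 1 ∨ (if g = 1 then (1 : Aˣ) else -1) = -1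
    split_ifs <;> simp

end Sign

/-! ## 3. The quadratic character of `Γ_K` cut out by a quadratic `L ⊆ K̄` -/

section QuadChar

variable {K : Type*} [Field K] (L : IntermediateField K (AlgebraicClosure K))
  [FiniteDimensional K L] [IsGalois K L]
  (A : Type*) [CommRing A] [TopologicalSpace A] [IsTopologicalRing A]

/-- **The quadratic Galois character `ε_L : Γ_K → Aˣ`** of a quadratic Galois subextension
`L ⊆ K̄`: the sign character of `Gal(L/K)` (order `2`) inflated along `Γ_K → Gal(L/K)`
(continuous: its kernel contains the open subgroup `Gal(K̄/L)`).  It is trivial on every `γ`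
with `γ|_L = 1`, takes the values `±1`, and is non-trivial (`Γ_K → Gal(L/K)` is onto).
[folklore] -/
theorem exists_quadraticGaloisChar (hL : Nat.card (L ≃ₐ[K] L) = 2) :
    ∃ ε : absoluteGaloisGroup K →ₜ* Aˣ, (∀ γ, absRestrictNormalHom L γ = 1 → ε γ = 1) ∧
      (∀ γ, ε γ = 1 ∨ ε γ = -1) ∧ ∃ γ₀, ε γ₀ = -1 := by
  obtain ⟨s, hs, hs'⟩ := exists_signChar A hL
  obtain ⟨g₀, hg₀, -⟩ := exists_ne_one_forall_eq_of_card_eq_two hL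
  obtain ⟨γ₀, hγ₀⟩ := absRestrictNormalHom_surjective L g₀
  refine ⟨⟨s.comp (absRestrictNormalHom L), MonoidHom.continuous_of_isOpen_ker _
      (Subgroup.isOpen_mono (fun γ hγ => ?_) (isOpen_ker_absRestrictNormalHom L))⟩,
    fun γ hγ => ?_, fun γ => hs _, γ₀, ?_⟩
  · rw [MonoidHom.mem_ker] at hγ ⊢
    rw [MonoidHom.comp_apply, hγ, map_one]
  · change s (absRestrictNormalHom L γ) = 1
    rw [hγ, map_one]
  · change s (absRestrictNormalHom L γ₀) = -1
    rw [hγ₀, hs' g₀ hg₀]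

variable [NumberField K] [NumberField L] {L A}

omit [FiniteDimensional K L] [IsTopologicalRing A] in
/-- **`ε_L` is trivial on the inertia groups above a prime unramified in `L`**
(`absRestrictNormalHom_eq_one_of_isUnramifiedIn`), for any `ε` trivial on `Gal(K̄/L)`.
[folklore] -/
theorem quadraticGaloisChar_eq_one_of_mem_inertia {ε : absoluteGaloisGroup K →ₜ* Aˣ}
    (hε : ∀ γ, absRestrictNormalHom L γ = 1 → ε γ = 1)
    {v : HeightOneSpectrum (𝓞 K)} (hunr : Algebra.IsUnramifiedIn (𝓞 L) v.asIdeal)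
    {𝔓 : Ideal (absIntegers (𝓞 K) K)} (h𝔓 : 𝔓 ∈ v.primesAbove) {g : absoluteGaloisGroup K}
    (hg : g ∈ 𝔓.inertia (absoluteGaloisGroup K)) : ε g = 1 :=
  hε g (absRestrictNormalHom_eq_one_of_isUnramifiedIn L hunr h𝔓 hg)

omit [FiniteDimensional K L] [IsTopologicalRing A] in
/-- **`ε_L` is trivial on the Frobenii above a prime unramified and of residue degree one in
`L`**: such a Frobenius restricts to `Frob_v ∈ Gal(L/K)` (abelian: `eq_galFrob`), and
`Frob_v^{f_v} = 1` with `f_v = 1`. [folklore] -/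
theorem quadraticGaloisChar_eq_one_of_isArithFrobAt (hL : Nat.card (L ≃ₐ[K] L) = 2)
    {ε : absoluteGaloisGroup K →ₜ* Aˣ} (hε : ∀ γ, absRestrictNormalHom L γ = 1 → ε γ = 1)
    {v : HeightOneSpectrum (𝓞 K)} (hunr : Algebra.IsUnramifiedIn (𝓞 L) v.asIdeal)
    (hf : v.asIdeal.inertiaDegIn (𝓞 L) = 1)
    {𝔓 : Ideal (absIntegers (𝓞 K) K)} (h𝔓 : 𝔓 ∈ v.primesAbove) {Φ : absoluteGaloisGroup K}
    (hΦ : IsArithFrobAt (𝓞 K) Φ 𝔓) : ε Φ = 1 := by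
  haveI : 𝔓.IsPrime := h𝔓.1
  haveI : IsCyclic (L ≃ₐ[K] L) := isCyclic_of_prime_card (p := 2) hL
  haveI : IsMulCommutative (L ≃ₐ[K] L) := IsCyclic.isMulCommutative
  have hcomm : ∀ a b : L ≃ₐ[K] L, Commute a b := fun a b => IsMulCommutative.is_comm.comm a b
  have hP := comap_ringOfIntegersToIntegralClosure_mem_primesOver_of_mem_primesAbove L h𝔓
  have hrΦ := isArithFrobAt_absRestrictNormalHom L hΦ
  have heq : absRestrictNormalHom L Φ = galFrob K L v := eq_galFrob hcomm hunr hP hrΦ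
  have hone : galFrob K L v = 1 := by
    have h := galFrob_pow_inertiaDegIn_eq_one (F := K) (L := L) hunr
    rwa [hf, pow_one] at h
  exact hε Φ (heq.trans hone)

end QuadChar

/-! ## 4. Traces vanishing at the inert primes force `ρ|_{Γ_F}` to be reducible -/

section Main

/-- `2 × 2` matrices: if `charpoly M = (X - x)(X - y)` then `charpoly (-M) = (X + x)(X + y)`
(read off trace and determinant). [folklore] -/
theorem charpoly_neg_of_charpoly_eq_fin_two {k : Type*} [Field k] (M : Matrix (Fin 2) (Fin 2) k)
    {x y : k} (h : M.charpoly = (X - C x) * (X - C y)) :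
    (-M).charpoly = (X - C (-x)) * (X - C (-y)) := by
  have h' : (X ^ 2 - C M.trace * X + C M.det : k[X]) = X ^ 2 - C (x + y) * X + C (x * y) := by
    rw [← Matrix.charpoly_fin_two, h, map_add, map_mul]; ring
  have hdet : M.det = x * y := by
    have h0 := congrArg (fun p : k[X] => p.coeff 0) h'
    simpa using h0
  have htr : M.trace = x + y := by
    have h1 := congrArg (fun p : k[X] => p.coeff 1) h'
    have h1' : -M.trace = -y + -x := by simpa using h1
    linear_combination -h1'
  rw [Matrix.charpoly_fin_two, Matrix.trace_neg, Matrix.det_neg, htr, hdet, Fintype.card_fin]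
  simp only [map_neg, map_add, map_mul, map_pow, map_one]
  ring

variable {p : ℕ} [Fact p.Prime] {K : Type} [Field K] [NumberField K]

/-- **Non-dihedral forms have non-zero trace at some inert prime** (Galois form of Ribet 1977,
§4: `π` has CM by `F` iff `a_ℓ(π) = 0` at the inert `ℓ`).  Let `F/K` be a quadratic extension of
number fields, `π` an automorphic representation of `GL₂(𝔸_K)` and `ρ : Γ_K → GL₂(ℚ̄_p)`
Satake–Frobenius compatible with `π` at almost every place.  If `ρ|_{Γ_F}` is irreducible, then at
some place `v` of `K` inert in `F` (a place `w ∣ v` of residue degree `[F:K]`) `π` has a Satake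
parameter `α` with `ζ • α ≠ α` for every primitive square root of unity `ζ` (i.e. `-α ≠ α`) — the
hypothesis of the named fact `baseChange_cyclic_cuspidal`.  See the module docstring for the proof
(Chebotarev + Brauer–Nesbitt, then Schur). [cite: Ribet1977Nebentypus, §4 (Prop. 4.4, Thm. 4.5)] -/
theorem exists_inert_hasSatakeParamAt_map_ne (F : Type) [Field F] [NumberField F] [Algebra K F]
    (hdeg : Module.finrank K F = 2) {hcpt : isCompact_glFiniteIntegralLevel 2 K}
    (ι : PadicAlgCl p ≃+* ℂ) (π : AutomorphicRepData (AutomorphyDatum.gl 2 K hcpt))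
    (ρ : FramedGaloisRep K (PadicAlgCl p) 2)
    (hcompat : ∀ᶠ v in cofinite, Summit.Langlands.SatakeFrobCompatibleAt ι π ρ v)
    (hirr : (ρ.restrictField F).toGaloisRep.IsIrreducible) :
    ∃ (v : HeightOneSpectrum (𝓞 K)) (w : HeightOneSpectrum (𝓞 F)) (α : Multiset ℂ),
      w.asIdeal.under (𝓞 K) = v.asIdeal ∧ w.asIdeal.inertiaDeg (𝓞 K) = Module.finrank K F ∧
      π.HasSatakeParamAt v α ∧
      ∀ ζ : ℂ, IsPrimitiveRoot ζ (Module.finrank K F) → α.map (ζ * ·) ≠ α := by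
  by_contra H
  push Not at H
  -- (0) `F/K` is Galois; a copy `L ⊆ K̄` of `F` with `res(Γ_F) ≤ Gal(K̄/L)`
  haveI : FiniteDimensional K F := Module.finite_of_finrank_pos (by rw [hdeg]; exact two_pos)
  haveI : Algebra.IsQuadraticExtension K F := ⟨hdeg⟩
  haveI : IsGalois K F := inferInstance
  obtain ⟨e, he⟩ := exists_mem_range_absGaloisRestrict_iff K F
  obtain ⟨L, hLdef⟩ : ∃ L, L = e.fieldRange := ⟨_, rfl⟩
  let e' : F ≃ₐ[K] L := e.equivFieldRange.trans (IntermediateField.equivOfEq hLdef.symm)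
  haveI := e'.toLinearEquiv.finiteDimensional
  haveI hGL := IsGalois.of_algEquiv e'
  haveI : NumberField L := NumberField.of_module_finite K L
  have hL2 : Module.finrank K L = 2 := e'.toLinearEquiv.finrank_eq ▸ hdeg
  have hcard : Nat.card (L ≃ₐ[K] L) = 2 := (IsGalois.card_aut_eq_finrank K L).trans hL2
  have hres : ∀ τ : absoluteGaloisGroup F, absRestrictNormalHom L (absGaloisRestrict K F τ) = 1 := by
    intro τ
    rw [absRestrictNormalHom_eq_one_iff, IntermediateField.mem_fixingSubgroup_iff]
    intro y hy
    rw [hLdef] at hy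
    obtain ⟨x, rfl⟩ := AlgHom.mem_fieldRange.mp hy
    have h1 := ((he _).mp ⟨τ, rfl⟩) x
    rwa [absoluteGaloisGroup.smul_def] at h1
  -- (1) the quadratic character and the twist
  obtain ⟨ε, hεL, hεpm, γ₀, hγ₀⟩ := exists_quadraticGaloisChar L (PadicAlgCl p) hcard
  set ρ' : FramedGaloisRep K (PadicAlgCl p) 2 := FramedRep.twist ρ ε with hρ'def
  have hcoe' : ∀ σ, ((ρ' σ : GL (Fin 2) (PadicAlgCl p)) : Matrix (Fin 2) (Fin 2) (PadicAlgCl p)) =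
      ((ε σ : (PadicAlgCl p)ˣ) : PadicAlgCl p) •
        ((ρ σ : GL (Fin 2) (PadicAlgCl p)) : Matrix (Fin 2) (Fin 2) (PadicAlgCl p)) :=
    fun σ => FramedRep.coe_twist_apply ρ ε σ
  -- (2) irreducibility of `ρ` and `ρ'`, hence semisimplicity
  have hρirr : ρ.toGaloisRep.IsIrreducible :=
    isIrreducible_of_coe_eq_smul (ρ.restrictField F) ρ (absGaloisRestrict K F) (fun _ => 1)
      (fun σ => by rw [one_smul, FramedGaloisRep.restrictField_apply]) hirr
  have hρ'irr : ρ'.toGaloisRep.IsIrreducible := by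
    refine isIrreducible_of_coe_eq_smul ρ ρ' id (fun σ => (((ε σ)⁻¹ : (PadicAlgCl p)ˣ) : PadicAlgCl p))
      (fun σ => ?_) hρirr
    rw [id, hcoe', smul_smul, Units.inv_mul, one_smul]
  have hss : ρ.toGaloisRep.IsSemisimple := by
    haveI : Representation.IsIrreducible ρ.toGaloisRep.toRepresentation := hρirr
    change ComplementedLattice _
    infer_instance
  have hss' : ρ'.toGaloisRep.IsSemisimple := by
    haveI : Representation.IsIrreducible ρ'.toGaloisRep.toRepresentation := hρ'irr
    change ComplementedLattice _
    infer_instance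
  -- (3) `ρ` and `ρ'` have the same Frobenius characteristic polynomials almost everywhere
  haveI : IsGaloisGroup (F ≃ₐ[K] F) (𝓞 K) (𝓞 F) := IsGaloisGroup.of_isFractionRing _ _ _ K F
  have hae : ∀ᶠ v : HeightOneSpectrum (𝓞 K) in cofinite, ρ.IsUnramifiedAt v ∧ ρ'.IsUnramifiedAt v ∧
      ∃ P : (PadicAlgCl p)[X], ρ.HasFrobCharpolyAt v P ∧ ρ'.HasFrobCharpolyAt v P := by
    filter_upwards [hcompat, eventually_isUnramifiedIn (K := K) L] with v hv hvL
    obtain ⟨α, hα, hunr, hP⟩ := hv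
    refine ⟨hunr, fun 𝔓 h𝔓 g hg => ?_, _, hP, fun 𝔓 h𝔓 Φ hΦ => ?_⟩
    · rw [hρ'def, FramedRep.twist_apply_of_eq_one ρ ε
        (quadraticGaloisChar_eq_one_of_mem_inertia hεL hvL h𝔓 hg)]
      exact hunr 𝔓 h𝔓 g hg
    · have hch : FramedRep.charpoly ρ Φ = arithFrobPolyOfSatake ι v.residueCard 1 α := hP 𝔓 h𝔓 Φ hΦ
      rcases hεpm Φ with h1 | h1
      · rw [FramedRep.charpoly, hρ'def, FramedRep.twist_apply_of_eq_one ρ ε h1]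
        exact hch
      · -- `ε Φ = -1`: `v` is inert in `F`
        obtain ⟨w, hw⟩ := exists_above (E := F) v
        have hf2 : w.asIdeal.inertiaDeg (𝓞 K) = 2 := by
          rcases inertiaDeg_eq_one_or_two_of_finrank_eq_two hdeg v w hw with hf1 | hf2
          · exfalso
            haveI : w.asIdeal.LiesOver v.asIdeal := ⟨hw.symm⟩
            haveI := v.isMaximal
            have hIn : v.asIdeal.inertiaDegIn (𝓞 L) = 1 := by
              rw [← inertiaDegIn_eq_of_algEquiv e' v.asIdeal,
                Ideal.inertiaDegIn_eq_inertiaDeg v.asIdeal w.asIdeal (F ≃ₐ[K] F)]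
              exact hf1
            have h2 := quadraticGaloisChar_eq_one_of_isArithFrobAt hcard hεL hvL hIn h𝔓 hΦ
            rw [h1] at h2
            have h3 : ((-1 : (PadicAlgCl p)ˣ) : PadicAlgCl p) = ((1 : (PadicAlgCl p)ˣ) : PadicAlgCl p) := by
              rw [h2]
            rw [Units.val_neg, Units.val_one] at h3
            exact two_ne_zero (α := PadicAlgCl p) (by linear_combination -h3)
          · exact hf2
        obtain ⟨ζ, hζ, hαζ⟩ := H v w α hw (hf2.trans hdeg.symm) hα
        rw [hdeg] at hζ
        obtain rfl : ζ = -1 := hζ.eq_neg_one_of_two_right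
        -- `α = {a, b}` with `{-a, -b} = {a, b}`
        obtain ⟨a, b, rfl⟩ := Multiset.card_eq_two.mp hα.card_eq
        simp only [Multiset.insert_eq_cons, Multiset.map_cons, Multiset.map_singleton, neg_mul,
          one_mul] at hαζ
        have key := congrArg
          (fun s : Multiset ℂ => (s.map fun c => (X - C (ι.symm c⁻¹) : (PadicAlgCl p)[X])).prod) hαζ
        simp only [Multiset.map_cons, Multiset.map_singleton, Multiset.prod_cons,
          Multiset.prod_singleton, inv_neg, map_neg] at key
        -- `charpoly ρ Φ = (X - x)(X - y)` with `x = ι⁻¹(a⁻¹)`, `y = ι⁻¹(b⁻¹)`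
        have hch' : ((ρ Φ : GL (Fin 2) (PadicAlgCl p)) : Matrix (Fin 2) (Fin 2) (PadicAlgCl p)).charpoly =
            (X - C (ι.symm a⁻¹)) * (X - C (ι.symm b⁻¹)) := by
          rw [FramedRep.charpoly, arithFrobPolyOfSatake_one] at hch
          simpa only [Multiset.insert_eq_cons, Multiset.map_cons, Multiset.map_singleton,
            Multiset.prod_cons, Multiset.prod_singleton] using hch
        rw [FramedRep.charpoly, hρ'def, FramedRep.twist_apply_of_eq_neg_one ρ ε h1, Units.val_neg,
          charpoly_neg_of_charpoly_eq_fin_two _ hch', arithFrobPolyOfSatake_one]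
        simp only [Multiset.insert_eq_cons, Multiset.map_cons, Multiset.map_singleton,
          Multiset.prod_cons, Multiset.prod_singleton, map_neg]
        exact key
  -- (4) `ρ ≅ ρ ⊗ ε`
  obtain ⟨eqv⟩ := FramedGaloisRep.nonempty_equiv_of_hasFrobCharpolyAt_eventually
    chebotarev_artinRep_holds ρ ρ' hss hss' hae
  -- (5) Schur: the intertwiner commutes with `ρ(Γ_F)`, hence is a scalar `c`
  let ρF : Representation (PadicAlgCl p) (absoluteGaloisGroup F) (Fin 2 → PadicAlgCl p) :=
    (ρ.restrictField F).toGaloisRep.toRepresentation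
  haveI : Representation.IsIrreducible ρF := hirr
  have hint : ∀ (τ : absoluteGaloisGroup F) (v : Fin 2 → PadicAlgCl p),
      eqv.toLinearEquiv (ρF τ v) = ρF τ (eqv.toLinearEquiv v) := by
    intro τ v
    have h1 := eqv.apply_apply (absGaloisRestrict K F τ) v
    have hε : ε (absGaloisRestrict K F τ) = 1 := hεL _ (hres τ)
    simp only [FramedRep.toContinuousRep_apply_apply] at h1
    rw [hcoe', hε, Units.val_one, one_smul] at h1
    exact h1
  let f : Representation.IntertwiningMap ρF ρF :=
    eqv.toLinearEquiv.toLinearMap.intertwiningMap_of_isIntertwiningMap ρF ρF hint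
  obtain ⟨c, hc⟩ :=
    (Representation.IsIrreducible.algebraMap_intertwiningMap_bijective_of_isAlgClosed (ρ := ρF)).2 f
  have hE : ∀ v : Fin 2 → PadicAlgCl p, eqv.toLinearEquiv v = c • v := fun v => by
    have h1 := congrArg (fun g : Representation.IntertwiningMap ρF ρF => g v) hc
    simp only [Representation.IntertwiningMap.algebraMap_apply,
      Representation.IntertwiningMap.smul_apply] at h1
    exact h1.symm
  -- (6) but `ε(γ₀) = -1`: contradiction
  set M : Matrix (Fin 2) (Fin 2) (PadicAlgCl p) :=
    ((ρ γ₀ : GL (Fin 2) (PadicAlgCl p)) : Matrix (Fin 2) (Fin 2) (PadicAlgCl p)) with hMdef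
  have hMu : IsUnit M.det := by
    rw [hMdef]
    exact (Matrix.isUnit_iff_isUnit_det _).mp (Units.isUnit _)
  have h1 := eqv.apply_apply γ₀ (M⁻¹ *ᵥ Pi.single 0 1)
  simp only [FramedRep.toContinuousRep_apply_apply] at h1
  rw [hcoe', hγ₀, Units.val_neg, Units.val_one, neg_smul, one_smul,
    ← hMdef, hE, hE, Matrix.mulVec_smul, Matrix.neg_mulVec, Matrix.mulVec_mulVec,
    Matrix.mul_nonsing_inv M hMu, Matrix.one_mulVec, smul_neg] at h1
  -- `h1 : c • e₀ = -(c • e₀)`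
  have h2 : (2 : PadicAlgCl p) • (c • (Pi.single 0 1 : Fin 2 → PadicAlgCl p)) = 0 := by
    rw [two_smul]
    nth_rewrite 2 [h1]
    exact add_neg_cancel _
  have hc0 : c = 0 := by
    have h3 := congrFun h2 0
    simp only [Pi.smul_apply, Pi.single_eq_same, smul_eq_mul, mul_one, Pi.zero_apply,
      mul_eq_zero] at h3
    exact h3.resolve_left two_ne_zero
  have h4 : eqv.toLinearEquiv (Pi.single 0 1) = 0 := by rw [hE, hc0, zero_smul]
  exact one_ne_zero (congrFun ((map_eq_zero_iff _ eqv.toLinearEquiv.injective).mp h4) 0)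

/-- **Registered auxiliary stub `stub_quadraticBaseChangeTwist_auxNonDihedral`** (support item of
stub S4 of the line `descend-raise-basechange`): the cuspidal case of
`exists_inert_hasSatakeParamAt_map_ne`, in the exact shape consumed by the named fact
`baseChange_cyclic_cuspidal`. [cite: Ribet1977Nebentypus, §4 (Prop. 4.4, Thm. 4.5)] -/
theorem stub_quadraticBaseChangeTwist_auxNonDihedral :
    ∀ (p : ℕ) [Fact p.Prime] (K : Type) [Field K] [NumberField K] (F : Type) [Field F] [NumberField F] [Algebra K F], Module.finrank K F = 2 → ∀ (hcpt : Literature.NumberTheory.Automorphic.isCompact_glFiniteIntegralLevel 2 K) (ι : PadicAlgCl p ≃+* ℂ) (π : Literature.NumberTheory.Automorphic.CuspidalAutomorphicRepData 2 K hcpt) (ρ : Literature.NumberTheory.GaloisRepresentations.FramedGaloisRep K (PadicAlgCl p) 2), (∀ᶠ v in Filter.cofinite, Summit.Langlands.SatakeFrobCompatibleAt ι π.1 ρ v) → (ρ.restrictField F).toGaloisRep.IsIrreducible → ∃ (v : IsDedekindDomain.HeightOneSpectrum (NumberField.RingOfIntegers K)) (w : IsDedekindDomain.HeightOneSpectrum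 (NumberField.RingOfIntegers F)) (α : Multiset ℂ), w.asIdeal.under (NumberField.RingOfIntegers K) = v.asIdeal ∧ w.asIdeal.inertiaDeg (NumberField.RingOfIntegers K) = Module.finrank K F ∧ π.1.HasSatakeParamAt v α ∧ ∀ ζ : ℂ, IsPrimitiveRoot ζ (Module.finrank K F) → Multiset.map (fun x => ζ * x) α ≠ α := by
  intro p _ K _ _ F _ _ _ hdeg hcpt ι π ρ hcompat hirr
  exact exists_inert_hasSatakeParamAt_map_ne F hdeg ι π.1 ρ hcompat hirr

end Main

end Summit.Langlands.Langlands.Theorems.SkinnerWilesDefectOne.EisensteinProModularSeed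

end
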